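import Summits.QuantumFields.GaugeBoot.FreeConfigurations
import HarnessLib

/-!
# Sharpness: for an ABELIAN gauge group a cyclically reduced loop CAN be identically trivial — the plaquette commutator (gauge-boot, large-`N` supplement 16, part 8)

HONEST FRAMING (cell `pub-gaugeboot`, page 1 of every file): the venture produces certified bounds
on lattice expectations at stated coupling, gauge group, dimension and torus size; NOT a mass gap,
NOT a continuum limit, NOT a string tension; NOT large `N` unless marked CONDITIONAL; NOT
Yang–Mills-summit-bearing (barriers `FixedCouplingUltralocality`, `PerturbativeInvisibility`).
Lattice combinatorics; this file certifies no number.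

## Content

Parts 2–7 need a free pair in the gauge group.  This part shows the hypothesis is not decoration: for a
COMMUTATIVE gauge group (`U(1)`, `SO(2)`, `ℤ_n`, the trivial group `SU(1)`) every conclusion fails.

* `plaqCommutatorWord a b = P Q P⁻¹ Q⁻¹` with `P = [a, b, a⁻¹, b⁻¹]` (the plaquette `plaqWord a b true`) and
  `Q = [a⁻¹, b⁻¹, a, b]` (the opposite plaquette): a CLOSED word of length `16` which is CYCLICALLY REDUCED
  whenever `a ≠ b` (`cyclicallyReduced_plaqCommutatorWord`);
* ★★ `wordHolonomyZd_plaqCommutatorWord_of_comm` — for every commutative `G` its holonomy is identically `1`;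
* hence, for commutative `G` and `d ≥ 2` (`exists_…_of_comm`): ★★ there IS a non-backtracking closed walk with
  holonomy identically `1` (`exists_isNonBacktrackingLoop_walkHolonomy_eq_one_of_comm`), the plaquette-walk
  hypothesis of supplement 9 IS satisfiable (`exists_isNonBacktrackingLoop_realising_plaqWord_self_of_comm`),
  reduced words are NOT separated by holonomy functions (`plaqCommutatorWord` vs `[]`), and the exact-domain
  statement of part 3/7 FAILS (the empty word — not cyclically reduced in the lane's sense, which demands
  non-emptiness — is realised).  So `N ≥ 2` in parts 2–5 (resp. `N ≥ 3` for `SO(N)`) is sharp.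

[folklore] (for abelian `G` the holonomy of a closed word depends only on its signed edge counts, i.e. on
its class in `H₁`; the commutator loop is null-homologous but not null-homotopic in the edge graph).
-/

noncomputable section

open SimpleGraph
open Literature.Probability.LatticeModels (Site zdGraph)
open Literature.MathematicalPhysics.QuantumLattice
open Literature.MathematicalPhysics.QuantumFieldTheory (IsNonBacktrackingLoop)

namespace Summit.QuantumFields.GaugeBoot

variable {d : ℕ}

/-! ## The plaquette commutator word -/

/-- The opposite plaquette `Q = [a⁻¹, b⁻¹, a, b]` (corners `x, x−e_a, x−e_a−e_b, x−e_b`). [folklore] -/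
def oppPlaqWord (a b : Fin d) : Word d := [.bwd a, .bwd b, .fwd a, .fwd b]

/-- **The plaquette commutator word** `P Q P⁻¹ Q⁻¹`, `P = plaqWord a b true = [a, b, a⁻¹, b⁻¹]`,
`Q = oppPlaqWord a b`. [folklore] -/
def plaqCommutatorWord (a b : Fin d) : Word d :=
  plaqWord a b true ++ oppPlaqWord a b ++ (plaqWord a b true).reverse ++ (oppPlaqWord a b).reverse

/-- The plaquette word is closed (re-proved by `simp`, four steps). [folklore] -/
theorem endpointZd_plaqWord_true (x : Site d) (a b : Fin d) : Word.endpointZd x (plaqWord a b true) = x := by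
  simp only [plaqWord, Word.endpointZd, Step.applyZd]
  abel

/-- The opposite plaquette word is closed. [folklore] -/
theorem endpointZd_oppPlaqWord (x : Site d) (a b : Fin d) : Word.endpointZd x (oppPlaqWord a b) = x := by
  simp only [oppPlaqWord, Word.endpointZd, Step.applyZd]
  abel

/-- A closed word's reverse is closed at the same point. [folklore] -/
theorem endpointZd_reverse_of_closed {x : Site d} {w : Word d} (h : Word.endpointZd x w = x) : Word.endpointZd x w.reverse = x := by
  have h' := Word.endpointZd_reverse x w
  rwa [h] at h'

/-- **The plaquette commutator word is closed.** [folklore] -/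
theorem endpointZd_plaqCommutatorWord (x : Site d) (a b : Fin d) : Word.endpointZd x (plaqCommutatorWord a b) = x := by
  rw [plaqCommutatorWord, Word.endpointZd_append, Word.endpointZd_append, Word.endpointZd_append, endpointZd_plaqWord_true,
    endpointZd_oppPlaqWord, endpointZd_reverse_of_closed (endpointZd_plaqWord_true x a b),
    endpointZd_reverse_of_closed (endpointZd_oppPlaqWord x a b)]

/-- The plaquette commutator word spelled out: `a b a⁻¹ b⁻¹ · a⁻¹ b⁻¹ a b · b a b⁻¹ a⁻¹ · b⁻¹ a⁻¹ b a` (length 16). [folklore] -/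
theorem plaqCommutatorWord_eq (a b : Fin d) : plaqCommutatorWord a b =
    [.fwd a, .fwd b, .bwd a, .bwd b, .bwd a, .bwd b, .fwd a, .fwd b, .fwd b, .fwd a, .bwd b, .bwd a, .bwd b, .bwd a, .fwd b, .fwd a] := by
  simp [plaqCommutatorWord, plaqWord, oppPlaqWord, Word.reverse, Step.inv]

/-- **It is cyclically reduced** as soon as `a ≠ b` (and non-empty). [folklore] -/
theorem cyclicallyReduced_plaqCommutatorWord {a b : Fin d} (hab : a ≠ b) : (plaqCommutatorWord a b).CyclicallyReduced := by
  rw [plaqCommutatorWord_eq, Word.CyclicallyReduced]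
  refine ⟨List.cons_ne_nil _ _, ?_⟩
  simp [Step.inv, hab, hab.symm]

/-- In particular it is reduced and non-empty. [folklore] -/
theorem isChain_plaqCommutatorWord {a b : Fin d} (hab : a ≠ b) : (plaqCommutatorWord a b).IsChain (fun s t => t ≠ s.inv) :=
  (cyclicallyReduced_plaqCommutatorWord hab).2.left_of_append

/-! ## Abelian gauge groups: the commutator loop is identically trivial -/

section Comm

variable {G : Type*} [CommGroup G]

/-- ★★ **For a commutative gauge group the plaquette commutator word has holonomy identically `1`.** [folklore] -/
theorem wordHolonomyZd_plaqCommutatorWord_of_comm (U : LGConfig d G) (x : Site d) (a b : Fin d) :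
    wordHolonomyZd U x (plaqCommutatorWord a b) = 1 := by
  have e1 : Word.endpointZd x (plaqWord a b true) = x := endpointZd_plaqWord_true x a b
  have e2 : Word.endpointZd x (oppPlaqWord a b) = x := endpointZd_oppPlaqWord x a b
  have e3 : Word.endpointZd x (plaqWord a b true).reverse = x := endpointZd_reverse_of_closed e1
  have e12 : Word.endpointZd x (plaqWord a b true ++ oppPlaqWord a b) = x := by rw [Word.endpointZd_append, e1, e2]
  have e123 : Word.endpointZd x (plaqWord a b true ++ oppPlaqWord a b ++ (plaqWord a b true).reverse) = x := by
    rw [Word.endpointZd_append, e12, e3]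
  rw [plaqCommutatorWord, wordHolonomyZd_append, e123, wordHolonomyZd_append, e12, wordHolonomyZd_append, e1]
  have hP := wordHolonomyZd_reverse U x (plaqWord a b true)
  have hQ := wordHolonomyZd_reverse U x (oppPlaqWord a b)
  rw [e1] at hP
  rw [e2] at hQ
  rw [hP, hQ, mul_inv_cancel_comm, mul_inv_cancel]

/-- ★★ **Abelian `G`, `d ≥ 2`: there IS a closed, cyclically reduced (non-empty, reduced) word whose holonomy is
identically `1`** — contrast `exists_config_wordHolonomyZd_ne_one_of_cyclicallyReduced` (`SU(N)`, `N ≥ 2`). [folklore] -/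
theorem exists_cyclicallyReduced_wordHolonomyZd_eq_one_of_comm (hd : 2 ≤ d) (x : Site d) :
    ∃ w : Word d, Word.endpointZd x w = x ∧ w.CyclicallyReduced ∧ ∀ U : LGConfig d G, wordHolonomyZd U x w = 1 :=
  ⟨plaqCommutatorWord ⟨0, by omega⟩ ⟨1, by omega⟩, endpointZd_plaqCommutatorWord x _ _,
    cyclicallyReduced_plaqCommutatorWord (by simp [Fin.ext_iff]), fun U => wordHolonomyZd_plaqCommutatorWord_of_comm U x _ _⟩

/-- ★★ **Abelian `G`, `d ≥ 2`: there IS a non-backtracking closed walk with holonomy identically `1`** — contrast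
`exists_config_walkHolonomy_ne_one_of_isNonBacktrackingLoop`. [folklore] -/
theorem exists_isNonBacktrackingLoop_walkHolonomy_eq_one_of_comm (hd : 2 ≤ d) (x : Site d) :
    ∃ γ : (zdGraph d).Walk x x, IsNonBacktrackingLoop γ ∧ ∀ U : LGConfig d G, walkHolonomy U γ = 1 := by
  obtain ⟨w, hx, hcr, hhol⟩ := exists_cyclicallyReduced_wordHolonomyZd_eq_one_of_comm (G := G) hd x
  exact ⟨Word.toLoopZd x w hx, isNonBacktrackingLoop_toLoopZd x w hx hcr, fun U => by rw [walkHolonomy_toLoopZd, hhol U]⟩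

/-- **Abelian `G`, `d ≥ 2`: the plaquette-walk hypothesis of supplement 9 IS satisfiable** (so is, e.g., `N = 1`) —
contrast `not_exists_isNonBacktrackingLoop_realising_plaqWord_self` (`SU(N)`, `N ≥ 2`). [folklore] -/
theorem exists_isNonBacktrackingLoop_realising_plaqWord_self_of_comm (hd : 2 ≤ d) (x : Site d) (a : Fin d) (ε : Bool) :
    ∃ γ : (zdGraph d).Walk x x, IsNonBacktrackingLoop γ ∧ ∀ U : LGConfig d G, walkHolonomy U γ = wordHolonomyZd U x (plaqWord a a ε) := by
  obtain ⟨γ, hγ, hhol⟩ := exists_isNonBacktrackingLoop_walkHolonomy_eq_one_of_comm (G := G) hd x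
  exact ⟨γ, hγ, fun U => by rw [hhol U, wordHolonomyZd_plaqWord_self]⟩

/-- **Abelian `G`, `d ≥ 2`: reduced words are NOT separated by their holonomy functions** (the commutator word and
the empty word agree on every configuration) — contrast `eq_of_forall_wordHolonomyZd_eq`. [folklore] -/
theorem exists_ne_forall_wordHolonomyZd_eq_of_comm (hd : 2 ≤ d) (x : Site d) :
    ∃ w w' : Word d, w.IsChain (fun s t => t ≠ s.inv) ∧ w'.IsChain (fun s t => t ≠ s.inv) ∧ w ≠ w' ∧
      ∀ U : LGConfig d G, wordHolonomyZd U x w = wordHolonomyZd U x w' := by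
  obtain ⟨w, -, hcr, hhol⟩ := exists_cyclicallyReduced_wordHolonomyZd_eq_one_of_comm (G := G) hd x
  exact ⟨w, [], hcr.2.left_of_append, List.IsChain.nil, hcr.1, fun U => by rw [hhol U, wordHolonomyZd_nil]⟩

/-- **Abelian `G`, `d ≥ 2`: the exact-domain statement of parts 3/7 FAILS** — the empty word (reduced, closed, but
not cyclically reduced in the lane's non-empty sense) IS realised by a non-backtracking closed walk. [folklore] -/
theorem exists_isNonBacktrackingLoop_realising_nil_of_comm (hd : 2 ≤ d) (x : Site d) :
    (∃ γ : (zdGraph d).Walk x x, IsNonBacktrackingLoop γ ∧ ∀ U : LGConfig d G, walkHolonomy U γ = wordHolonomyZd U x []) ∧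
      ¬ (Word.endpointZd x ([] : Word d) = x ∧ Word.CyclicallyReduced ([] : Word d)) := by
  refine ⟨?_, fun h => h.2.1 rfl⟩
  obtain ⟨γ, hγ, hhol⟩ := exists_isNonBacktrackingLoop_walkHolonomy_eq_one_of_comm (G := G) hd x
  exact ⟨γ, hγ, fun U => by rw [hhol U, wordHolonomyZd_nil]⟩

/-- **Hence an abelian group has no free pair** (read off the lattice: a free pair would separate reduced words). [folklore] -/
theorem not_injective_of_comm (ψ : FreeGroup (Fin 2) →* G) : ¬ Function.Injective ψ := by
  intro hψ
  obtain ⟨w, w', hred, hred', hne, h⟩ := exists_ne_forall_wordHolonomyZd_eq_of_comm (G := G) (d := 2) le_rfl 0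
  exact hne (eq_of_forall_wordHolonomyZd_eq_of_freePair ψ hψ 0 hred hred' h)

end Comm

end Summit.QuantumFields.GaugeBoot

end
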